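import Mathlib
import HarnessLib
import Summits.HubbardSuperconductivity.HubbardSuperconductivity.Theorems.KLProgrammeKLRegimeEngineE4ScaleDoor
import Summits.HubbardSuperconductivity.HubbardSuperconductivity.Theorems.KLProgrammeKLRegimeTwoVolumeGluedProfiles

/-!
# Route `KLProgramme` — crux K3 ENGINE (stmt-HubbardSuperconductivity-20437 `KLRegimeEngineV17F2`), stub (b) v2 (ℓ) / located-risk #10 cure (ε), instantiation (I):
# THE SCALE TREE WEIGHT `klScaleWt` IS TRANSLATION INVARIANT on the space-time torus (read through `latticeLegPos`)
# (cell gate-hubbard-kl, seat hubbard-kl-k3c3-p2 g15; the weight-side half of the translation argument behind `hNsw` — the kernel side is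
#  `…EnginePlaneWaveConservation.norm_sectorisedKernel_translate`; together they make the WEIGHTED position-only pin of the oriented engine
#  (`GrassmannWeightedEffectiveActionGradedTruncationOrientedDB`, k3c2-p3 g13: summand `‖K Y‖·wt (univ.image Y)`) translation invariant)

* §1 `cyclicDist_add_right`, `torusSiteDist_add_right`, `gridLabelDist_add_right` — the bookkeeping distances are translation invariant;
  **`klScaleWt_image_add_right`** — `klScaleWt … (S.image (· + c)) = klScaleWt … S` (`diamWeight_image_eq_of_isometry`);
* §2 **`latticeLegPos_translate`** — translating a lattice leg by `a` translates its grid position by `(2·a₀, a⃗)` (`2·(u mod 2M) ≡ 2u (mod 4M)`);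
  **`klScaleWt_image_latticeLegPos_translate`** (tuple form `Y i ↦ ((Y i).1 + a, (Y i).2)`) and **`…_translate'`** (split form `(x i + a, σ i)`): the weight of a
  translated labelled tuple is the weight of the tuple.
Pure bookkeeping; nothing about the model is asserted; nothing asserts (ℓ), any stub, K3 or superconductivity.
References: BGM 2006 §2.3 (2.17), §3 (3.2)–(3.8) [cite: BenfattoGiulianiMastropietro2006].
-/

noncomputable section

namespace Summit.HubbardSuperconductivity.HubbardSuperconductivity.Theorems.EngineV8

set_option linter.dupNamespace false -- summit = problem name (single-conjunct summit), D-0017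

open Finset Literature.MathematicalPhysics.QuantumLattice Literature.Probability.LatticeModels Literature.Probability.LatticeModels.BattleFederbush

/-! ## §1 The bookkeeping distances and the weight are translation invariant -/

/-- The cyclic distance is translation invariant. -/
theorem cyclicDist_add_right (n : ℕ) (a b c : ZMod n) : cyclicDist n (a + c) (b + c) = cyclicDist n a b := by
  unfold cyclicDist
  rw [add_sub_add_right_eq_sub]

/-- The periodic `ℓ^∞` distance of torus sites is translation invariant. -/
theorem torusSiteDist_add_right {d L : ℕ} (x y v : TorusSite d L) : torusSiteDist (x + v) (y + v) = torusSiteDist x y := by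
  simp [torusSiteDist, torusDist]

/-- The grid bookkeeping distance is translation invariant. -/
theorem gridLabelDist_add_right (L Ng : ℕ) (β : ℝ) (a b c : ZMod Ng × TorusSite 2 L) :
    gridLabelDist L Ng β (a + c) (b + c) = gridLabelDist L Ng β a b := by
  rw [gridLabelDist_apply, gridLabelDist_apply, Prod.fst_add, Prod.fst_add, Prod.snd_add, Prod.snd_add, cyclicDist_add_right, torusSiteDist_add_right]

/-- **`klScaleWt` is translation invariant**: `klScaleWt … (S.image (· + c)) = klScaleWt … S`. -/
theorem klScaleWt_image_add_right (L M : ℕ) (β : ℝ) (n : ℕ) (S : Finset (ZMod (2 * (2 * M)) × TorusSite 2 L)) (c : ZMod (2 * (2 * M)) × TorusSite 2 L) :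
    klScaleWt L M β n (S.image (· + c)) = klScaleWt L M β n S := by
  unfold klScaleWt
  exact TwoVolumeDefect.diamWeight_image_eq_of_isometry _ _ _ (· + c) (fun a b => gridLabelDist_add_right L _ β a b c) S

/-! ## §2 Translating lattice legs -/

/-- **Translating a lattice leg translates its grid position**: `latticeLegPos (4M) ((x + a), ℓ) = latticeLegPos (4M) (x, ℓ) + (2·a₀, a⃗)` — the imaginary-time
index `x₀ + a₀ (mod 2M)` doubles to `2x₀ + 2a₀ (mod 4M)`. -/
theorem latticeLegPos_translate {L M Ns : ℕ} (Y : SpaceTimeIdx L M × SectorLeg Ns) (a : SpaceTimeIdx L M) :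
    latticeLegPos (2 * (2 * M)) ((((Y.1.1 + a.1, Y.1.2 + a.2) : SpaceTimeIdx L M), Y.2) : SpaceTimeIdx L M × SectorLeg Ns) =
      latticeLegPos (2 * (2 * M)) Y + ((((2 * (a.1 : ℕ) : ℕ) : ZMod (2 * (2 * M)))), a.2) := by
  rw [latticeLegPos_apply, latticeLegPos_apply, Prod.mk_add_mk]
  congr 1
  rw [Fin.val_add, ← Nat.mul_mod_mul_left, ZMod.natCast_mod, Nat.mul_add, Nat.cast_add]

/-- **The weight of a translated labelled tuple is the weight of the tuple** (tuple form: `Y i ↦ ((Y i).1 + a, (Y i).2)` componentwise). -/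
theorem klScaleWt_image_latticeLegPos_translate {L M Ns : ℕ} {ι : Type*} [Fintype ι] [DecidableEq ι] (β : ℝ) (n : ℕ)
    (Y : ι → SpaceTimeIdx L M × SectorLeg Ns) (a : SpaceTimeIdx L M) :
    klScaleWt L M β n ((univ.image fun i => (((((Y i).1.1 + a.1, (Y i).1.2 + a.2) : SpaceTimeIdx L M), (Y i).2) : SpaceTimeIdx L M × SectorLeg Ns)).image
        (latticeLegPos (2 * (2 * M)))) =
      klScaleWt L M β n ((univ.image Y).image (latticeLegPos (2 * (2 * M)))) := by
  classical
  set c : ZMod (2 * (2 * M)) × TorusSite 2 L := ((((2 * (a.1 : ℕ) : ℕ) : ZMod (2 * (2 * M)))), a.2) with hc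
  have himg : (univ.image fun i => (((((Y i).1.1 + a.1, (Y i).1.2 + a.2) : SpaceTimeIdx L M), (Y i).2) : SpaceTimeIdx L M × SectorLeg Ns)).image
      (latticeLegPos (2 * (2 * M))) = ((univ.image Y).image (latticeLegPos (2 * (2 * M)))).image (· + c) := by
    rw [image_image, image_image, image_image]
    refine image_congr fun i _ => ?_
    simp only [Function.comp_apply]
    rw [latticeLegPos_translate]
  rw [himg, klScaleWt_image_add_right]

/-- **The weight of a translated labelled tuple is the weight of the tuple** (split form: positions `x i + a`, labels `σ i` unchanged). -/
theorem klScaleWt_image_latticeLegPos_translate' {L M Ns : ℕ} [NeZero M] {ι : Type*} [Fintype ι] [DecidableEq ι] (β : ℝ) (n : ℕ)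
    (x : ι → SpaceTimeIdx L M) (σ : ι → SectorLeg Ns) (a : SpaceTimeIdx L M) :
    klScaleWt L M β n ((univ.image fun i => ((x i + a, σ i) : SpaceTimeIdx L M × SectorLeg Ns)).image (latticeLegPos (2 * (2 * M)))) =
      klScaleWt L M β n ((univ.image fun i => ((x i, σ i) : SpaceTimeIdx L M × SectorLeg Ns)).image (latticeLegPos (2 * (2 * M)))) :=
  klScaleWt_image_latticeLegPos_translate β n (fun i => ((x i, σ i) : SpaceTimeIdx L M × SectorLeg Ns)) a

end Summit.HubbardSuperconductivity.HubbardSuperconductivity.Theorems.EngineV8
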